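import Summits.Ventures.HSemireg.ObstructionLocusCrossingExtTop
import Summits.Ventures.HSemireg.ObstructionLocusCrossingMidTools
import Summits.Ventures.HSemireg.ObstructionLocusCrossingMidCore
import Summits.Ventures.HSemireg.ObstructionLocusBlockExtAll

/-!
# Venture HSemireg — (S5) OBSTRUCTION LOCUS away from secant type, XLI: EXT-NOTE §6.B(c) IN THE MIDDLE DEGREE AT A
# TRIPLE POINT, KÜNNETH-FREE — for every THREE-block model, `Ext²_R(I_M, I_M)` is an extension of
# `Π_{τ′} R ⧸ J_{τ′}` (the crossing of the two other blocks) by `Π_{t′ ∈ Br(M′)} Π_{t ∈ Br(S)} R ⧸ ((x_b,x_a) + (x_{b′},x_{a′}))`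
# (the two crossings through the peeled block `S`), over ANY commutative ring

HONEST FRAMING.  Part of the Lean side of the computation cell `pub-hsemireg` (track «S4-PUSH» (ii), seat
s4-prove-2).  Plain commutative / homological algebra in `R = MvPolynomial (Fin n) K`, every `n`, EVERY commutative
ring `K`, with Mathlib's derived `CategoryTheory.Abelian.Ext`.  Nothing here constructs a variety or a sheaf; nothing
here says that HC / HC_CM / HC_AV holds; no Literature fact is declared or used; no object is certified.

THE STATEMENT (EXT-NOTE §6.B(c), `r = 3`, `q = 2` — the one middle degree at a point through which three translates
pass, e.g. the triple point `K₂ ⊔ K₂ ⊔ K₂` of a (GEN) design in `E⁶`).  For a block model `M` with blocks `S = S_{i₀}` and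
two more (`M′`, file XXVII's `Blocks.restrict`; `I_M = I_S ∩ I_{M′}`), let `∂ : Ext¹(I_{M′}^{S∖a₀}, I_M) → Ext²(I_M, I_M)` be the
connecting map of the dévissage `0 → I_{M′}^{S∖a₀} →Φ I_{M′}^S → I_M → 0` (files XXVII/XXVIII).  Then (`midSub = range ∂`):
* **`midSubEquiv`**: `range ∂ ≃ₗ[R] Π_{t′ ∈ Br(M′)} Π_{t ∈ Br(S)} R ⧸ ((x_{t.b}, x_{t.a}) + (x_{t′.b}, x_{t′.a}))` — rank `4 = 2·2` on
  `B ∩ B′` for every component `B` of the peeled translate and every component `B′` of either other translate;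
* **`midQuotEquiv`**: `Ext²_R(I_M, I_M) ⧸ range ∂ ≃ₗ[R] Π_{τ′ ∈ BranchTuple M′} R ⧸ J_{τ′}` — rank `4` on `B′ ∩ B″` for every pair
  of components of the two other translates (file XXXV's `Ext²(I_{M′}, I_{M′})`, as `Hom_R(I_S, I_S) ⊗ −`).
So every stalk of `𝓔xt²(I_Z, I_Z)` at a triple point carries exactly the three pairwise plane terms — as an EXTENSION
(a direct-sum splitting would need base change for `Ext`, absent here); together with files XXIX (`q = 1`), XXX
(`𝓔xt^{>3} = 0`), XXXV (`q = r = 2`) and XXXVII (`q = r`, any `r`) this gives every stalk number of EXT-NOTE §6.D's E₂ page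
for (GEN) designs in `Eⁿ`, `n ≤ 7`, with any number of translates.  (`midSubEquivArr`, `midQuotEquivArr`: the same on
`arrIdeal K B`; `_ofCardEqThree`: with `Fintype.card ι = 3`; `midQuotEquivExt`: the quotient piece as `Ext²_R(I_{M′}, I_{M′})` itself.)

THE PROOF (no Künneth formula, no grading; `V := I_{M′}`, `pd_R V = 2`, `E_j := Ext^j_R(V, V)`: `E₁ = N′` by file XXIX,
`E₂ = Π_{τ′} R ⧸ J_{τ′}` by file XXXV/XXXVII, `E₃ = 0` by file XXX).
SUB: `range ∂ = Ext¹(V^{S∖a₀}, I_M) ⧸ Φ^*` (file XXXVIII); `Ext¹(V, I_M) = Ext¹(V, V^S) ⧸ Φ_*` because `Φ_*` is INJECTIVE on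
`Ext²(V, V^{S∖a₀}) = E₂^{S∖a₀}` (file XXXVIII's `extCokernelEquivOfInjective'`; injectivity: `Φ` on `(Π R ⧸ J)`-valued vectors,
`x_a` a non-zero-divisor modulo the other blocks' variables, file XXXIX); then flatten + product + `yQuotEquiv` exactly as
in file XXXV.  QUOTIENT: `Ext² ⧸ range ∂ = ker(Φ^* on Ext²(V^S, I_M))` (file XXXVIII); `Ext²(V, I_M) = E₂^S ⧸ Φ E₂^{S∖a₀}`
(file XXXVII's `stepTwoK`, `E₃ = 0`); kernels commute with the product over `τ′` (file XXXVIII) and, factor by factor,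
`ker(Φᵀ on (R̄^S ⧸ Φ̄)-vectors) = R̄` is file XL's `kerTransposeEquiv` (`R̄ = R ⧸ J_{τ′}`).
References (dictionary only): EXT-NOTE.md §6.A, §6.B(c), §6.D.
-/

open CategoryTheory CategoryTheory.Abelian MvPolynomial Finset
open scoped BigOperators

universe u

namespace Summit.Ventures.HSemireg.ObstructionLocus.BlockModel

variable {K : Type u} [CommRing K] {n : ℕ}

/-! ## Generic: kernels along a commuting square of equivalences; injective actions along equivalences -/

section Generic

variable {A : Type u} [CommRing A] {M M' N N' : Type u} [AddCommGroup M] [Module A M] [AddCommGroup M'] [Module A M']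
  [AddCommGroup N] [Module A N] [AddCommGroup N'] [Module A N']

/-- If `e' ∘ f = g ∘ e` for linear equivalences `e`, `e'`, then `e` maps `ker f` onto `ker g`. -/
theorem map_ker_eq_of_square (f : M →ₗ[A] M') (g : N →ₗ[A] N') (e : M ≃ₗ[A] N) (e' : M' ≃ₗ[A] N')
    (h : ∀ x, e' (f x) = g (e x)) : (LinearMap.ker f).map (e : M →ₗ[A] N) = LinearMap.ker g := by
  ext y
  simp only [Submodule.mem_map, LinearMap.mem_ker, LinearEquiv.coe_coe]
  constructor
  · rintro ⟨x, hx, rfl⟩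
    rw [← h, hx, map_zero]
  · intro hy
    refine ⟨e.symm y, ?_, LinearEquiv.apply_symm_apply e y⟩
    apply e'.injective
    rw [h, LinearEquiv.apply_symm_apply, hy, map_zero]

/-- `ker f ≃ₗ[A] ker g` along a commuting square of equivalences. -/
noncomputable def kerEquivOfSquare (f : M →ₗ[A] M') (g : N →ₗ[A] N') (e : M ≃ₗ[A] N) (e' : M' ≃ₗ[A] N')
    (h : ∀ x, e' (f x) = g (e x)) : ↥(LinearMap.ker f) ≃ₗ[A] ↥(LinearMap.ker g) :=
  (e.submoduleMap (LinearMap.ker f)).trans (LinearEquiv.ofEq _ _ (map_ker_eq_of_square f g e e' h))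

/-- An injective scalar action transports along a linear equivalence. -/
theorem smul_injective_of_equiv (e : M ≃ₗ[A] N) (r : A) (h : Function.Injective fun y : N => r • y) :
    Function.Injective fun x : M => r • x := by
  intro x x' hxx'
  apply e.injective
  apply h
  change r • e x = r • e x'
  rw [← map_smul, ← map_smul]
  exact congrArg e hxx'

end Generic

/-! ## Branch tuples: the variables they use -/

section TupleVars

variable {ι : Type} [Fintype ι] (B : Blocks ι n)

/-- The coordinates used by a branch tuple: `⋃_i {a_i, b_i}`. -/
def tupleVars (τ : BranchTuple B) : Finset (Fin n) :=
  Finset.univ.biUnion fun i => ({(τ i).1.2.1, (τ i).1.2.2} : Finset (Fin n))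

/-- Membership in `tupleVars`. -/
theorem mem_tupleVars_iff (τ : BranchTuple B) (c : Fin n) :
    c ∈ tupleVars B τ ↔ ∃ i, c = (τ i).1.2.1 ∨ c = (τ i).1.2.2 := by
  simp [tupleVars]

/-- The coordinates of a branch tuple lie in the blocks. -/
theorem mem_block_of_mem_tupleVars (τ : BranchTuple B) {c : Fin n} (hc : c ∈ tupleVars B τ) : ∃ i, c ∈ B.S i := by
  obtain ⟨i, h | h⟩ := (mem_tupleVars_iff B τ c).1 hc
  · exact ⟨i, h ▸ (τ i).2.1⟩
  · exact ⟨i, h ▸ Finset.mem_of_mem_erase (τ i).2.2⟩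

/-- **The tuple ideal is the ideal of the tuple's variables**: `J_τ = (x_c : c ∈ tupleVars τ)`. -/
theorem tupleIdeal_eq_varIdeal (τ : BranchTuple B) : tupleIdeal K B τ = varIdeal K (tupleVars B τ) := by
  apply le_antisymm
  · refine iSup_le fun i => ?_
    rw [Ideal.span_le]
    intro f hf
    rcases Set.mem_insert_iff.1 hf with h | h
    · rw [h]
      exact X_mem_varIdeal _ ((mem_tupleVars_iff B τ _).2 ⟨i, Or.inr rfl⟩)
    · rw [Set.mem_singleton_iff.1 h]
      exact X_mem_varIdeal _ ((mem_tupleVars_iff B τ _).2 ⟨i, Or.inl rfl⟩)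
  · rw [varIdeal, Ideal.span_le]
    rintro _ ⟨c, hc, rfl⟩
    obtain ⟨i, h | h⟩ := (mem_tupleVars_iff B τ c).1 (Finset.mem_coe.1 hc)
    · refine Ideal.mem_iSup_of_mem i (Ideal.subset_span ?_)
      rw [h]; exact Or.inr rfl
    · refine Ideal.mem_iSup_of_mem i (Ideal.subset_span ?_)
      rw [h]; exact Or.inl rfl

end TupleVars

/-! ## The three-block setting -/

section ThreeBlocks

variable {ι : Type} [Fintype ι] [DecidableEq ι] (B : Blocks ι n) (i₀ : ι) {a₀ : Fin n} (ha₀ : a₀ ∈ B.S i₀)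
  (h2 : Fintype.card {j // j ≠ i₀} = 2)

/-- The coordinates of a branch tuple of the OTHER blocks avoid the peeled block `S_{i₀}`. -/
theorem notMem_tupleVars_restrict (τ : BranchTuple (B.restrict (· ≠ i₀))) {a : Fin n} (ha : a ∈ B.S i₀) :
    a ∉ tupleVars (B.restrict (· ≠ i₀)) τ := by
  intro h
  obtain ⟨j, hj⟩ := mem_block_of_mem_tupleVars _ τ h
  rw [Blocks.restrict_S] at hj
  exact Finset.disjoint_left.1 (B.disjoint j.2) hj ha

include h2 in
/-- `pd_R V ≤ 2` for the two other blocks: `Ext³_R(V, −) = 0`. -/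
theorem ext_three_otherIdeal_eq_zero (Y : ModuleCat.{u} (MvPolynomial (Fin n) K))
    (e : Ext.{u} (ModuleCat.of (MvPolynomial (Fin n) K) ↥(otherIdeal (K := K) B i₀)) Y 3) : e = 0 :=
  haveI := ext_arrIdeal_subsingleton_of_card_lt (K := K) (B.restrict (· ≠ i₀)) Y (i := 3) (by rw [h2]; norm_num)
  Subsingleton.elim _ _

/-- The modules `Q_{τ′} = R ⧸ J_{τ′}` over the branch tuples of the other blocks. -/
noncomputable abbrev QTuple (τ : BranchTuple (B.restrict (· ≠ i₀))) : Type u :=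
  MvPolynomial (Fin n) K ⧸ tupleIdeal K (B.restrict (· ≠ i₀)) τ

/-- `E₂ = Ext²_R(V, V) ≃ₗ[R] Π_{τ′} R ⧸ J_{τ′}` (file XXXVII for the two other blocks). -/
noncomputable def eTwo :
    EPrimeK (K := K) B i₀ 2 ≃ₗ[MvPolynomial (Fin n) K] ((τ : BranchTuple (B.restrict (· ≠ i₀))) → QTuple (K := K) B i₀ τ) :=
  extEquivOfCardEq (K := K) (B.restrict (· ≠ i₀)) h2

/-- Every `x_a`, `a ∈ S_{i₀}`, acts injectively on `R ⧸ J_{τ′}`. -/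
theorem X_smul_QTuple_injective (τ : BranchTuple (B.restrict (· ≠ i₀))) {a : Fin n} (ha : a ∈ B.S i₀) :
    Function.Injective fun m : QTuple (K := K) B i₀ τ => (X a : MvPolynomial (Fin n) K) • m :=
  smul_injective_of_equiv
    (Submodule.quotEquivOfEq _ _ (tupleIdeal_eq_varIdeal (K := K) (B.restrict (· ≠ i₀)) τ))
    (X a) (X_smul_quot_injective _ (notMem_tupleVars_restrict B i₀ τ ha))

include h2 in
/-- Every `x_a`, `a ∈ S_{i₀}`, acts injectively on `E₂ = Ext²_R(V, V)`. -/
theorem X_smul_EPrimeK_two_injective {a : Fin n} (ha : a ∈ B.S i₀) :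
    Function.Injective fun m : EPrimeK (K := K) B i₀ 2 => (X a : MvPolynomial (Fin n) K) • m :=
  smul_injective_of_equiv (eTwo (K := K) B i₀ h2) (X a)
    (X_smul_pi_injective _ (X a) fun τ => X_smul_QTuple_injective (K := K) B i₀ τ ha)

/-! ### The two naturality squares (file XXXVII's `key` computations, as lemmas) -/

omit [Fintype ι] [DecidableEq ι] in
/-- Under `extPiEquiv`, `Φ^*` is `Φᵀ` on `Ext^k(V, I_M)`-valued vectors. -/
theorem extPiEquiv_extPrecomp (k : ℕ)
    (ζ : Ext.{u} (ModuleCat.of (MvPolynomial (Fin n) K) (↥(B.S i₀) → ↥(otherIdeal (K := K) B i₀)))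
      (ModuleCat.of (MvPolynomial (Fin n) K) ↥(blockIdeal K (B.S i₀) ⊓ otherIdeal (K := K) B i₀)) k) :
    extPiEquiv ↥(otherIdeal (K := K) B i₀) ↥((B.S i₀).erase a₀)
        (ModuleCat.of (MvPolynomial (Fin n) K) ↥(blockIdeal K (B.S i₀) ⊓ otherIdeal (K := K) B i₀)) k
        (extPrecomp (S := devissage (B.S i₀) (otherIdeal (K := K) B i₀) ha₀) _ k ζ) =
      scalarMatrix (EK (K := K) B i₀ k) (fun b a => hbMatrix (K := K) (B.S i₀) a₀ a b)
        (extPiEquiv ↥(otherIdeal (K := K) B i₀) ↥(B.S i₀) _ k ζ) := by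
  funext b
  rw [extPrecomp_apply, devissage_f, extPiEquiv_precomp_scalarMatrix, scalarMatrix_apply]

omit [Fintype ι] [DecidableEq ι] in
/-- Under `extCoPiEquiv`, `Φ_*` is `Φ` on `Ext^k(V, V)`-valued vectors. -/
theorem extCoPiEquiv_extPostcomp (k : ℕ)
    (ζ : Ext.{u} (ModuleCat.of (MvPolynomial (Fin n) K) ↥(otherIdeal (K := K) B i₀))
      (ModuleCat.of (MvPolynomial (Fin n) K) (↥((B.S i₀).erase a₀) → ↥(otherIdeal (K := K) B i₀))) k) :
    extCoPiEquiv ↥(otherIdeal (K := K) B i₀) ↥(B.S i₀) (ModuleCat.of (MvPolynomial (Fin n) K) ↥(otherIdeal (K := K) B i₀)) k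
        (extPostcomp (S := devissage (B.S i₀) (otherIdeal (K := K) B i₀) ha₀) _ k ζ) =
      scalarMatrix (EPrimeK (K := K) B i₀ k) (hbMatrix (K := K) (B.S i₀) a₀)
        (extCoPiEquiv ↥(otherIdeal (K := K) B i₀) ↥((B.S i₀).erase a₀) _ k ζ) := by
  funext b
  rw [extPostcomp_apply, devissage_f, extCoPiEquiv_postcomp_scalarMatrix, scalarMatrix_apply]

include h2 in
/-- **`Φ_*` is injective on `Ext²(V, V^{S∖a₀})`** (`= E₂^{S∖a₀}`; `Φ` on `(Π R ⧸ J)`-valued vectors, every `x_a` a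
non-zero-divisor). -/
theorem extPostcomp_two_injective :
    Function.Injective (extPostcomp (S := devissage (B.S i₀) (otherIdeal (K := K) B i₀) ha₀)
      (ModuleCat.of (MvPolynomial (Fin n) K) ↥(otherIdeal (K := K) B i₀)) 2) := by
  intro ζ ζ' h
  have h' := congrArg (extCoPiEquiv ↥(otherIdeal (K := K) B i₀) ↥(B.S i₀)
    (ModuleCat.of (MvPolynomial (Fin n) K) ↥(otherIdeal (K := K) B i₀)) 2) h
  rw [extCoPiEquiv_extPostcomp B i₀ ha₀ 2, extCoPiEquiv_extPostcomp B i₀ ha₀ 2] at h'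
  have hinj := scalarMatrix_hbMatrix_injective_of_smul_injective (K := K) (B.S i₀) a₀ (M := EPrimeK (K := K) B i₀ 2)
    (fun _ ha _ => X_smul_EPrimeK_two_injective (K := K) B i₀ h2 ha)
  exact (extCoPiEquiv ↥(otherIdeal (K := K) B i₀) ↥((B.S i₀).erase a₀) _ 2).injective (hinj h')

/-! ### The sub-module `range ∂` and its structure -/

/-- The canonical sub-module of `Ext²_R(I_M, I_M)` (`I_M = I_S ∩ V`): the image of the connecting map
`∂ : Ext¹(V^{S∖a₀}, I_M) → Ext²(I_M, I_M)` of the dévissage. -/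
noncomputable def midSub : Submodule (MvPolynomial (Fin n) K)
    (Ext.{u} (ModuleCat.of (MvPolynomial (Fin n) K) ↥(blockIdeal K (B.S i₀) ⊓ otherIdeal (K := K) B i₀))
      (ModuleCat.of (MvPolynomial (Fin n) K) ↥(blockIdeal K (B.S i₀) ⊓ otherIdeal (K := K) B i₀)) 2) :=
  LinearMap.range (extConnecting (devissage_shortExact_twoBlocks (K := K) B i₀ ha₀)
    (ModuleCat.of (MvPolynomial (Fin n) K) ↥(blockIdeal K (B.S i₀) ⊓ otherIdeal (K := K) B i₀)) 1)

/-- Step (2) at degree `1` with injectivity: `E₁ = Ext¹(V, I_M) ≃ₗ[R] N′^S ⧸ range Φ`, `N′ = Ext¹(V, V)` the branch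
functions of the other blocks (file XXIX). -/
noncomputable def stepTwoOne :
    EK (K := K) B i₀ 1 ≃ₗ[MvPolynomial (Fin n) K]
      ((↥(B.S i₀) → BranchFunctions K (B.restrict (· ≠ i₀))) ⧸
        LinearMap.range (scalarMatrix (BranchFunctions K (B.restrict (· ≠ i₀))) (hbMatrix (K := K) (B.S i₀) a₀))) :=
  ((extCokernelEquivOfInjective' (devissage_shortExact_twoBlocks (K := K) B i₀ ha₀)
      (ModuleCat.of (MvPolynomial (Fin n) K) ↥(otherIdeal (K := K) B i₀)) 1
      (extPostcomp_two_injective (K := K) B i₀ ha₀ h2)).symm.trans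
    (Submodule.Quotient.equiv _ _ _ (map_range_extPostcomp_eq_degree (K := K) B i₀ ha₀ 1))).trans
    (quotRangeCongr (hbMatrix (K := K) (B.S i₀) a₀) (extOneEquivBlocks K (B.restrict (· ≠ i₀))))

/-- **THE SUB-PIECE: `range ∂ ≃ₗ[R] Π_{t′ ∈ Br(M′)} Π_{t ∈ Br(S)} R ⧸ ((x_{t.b}, x_{t.a}) + (x_{t′.b}, x_{t′.a}))`** — the two
pairwise crossings through the peeled block. -/
noncomputable def midSubEquiv :
    ↥(midSub (K := K) B i₀ ha₀) ≃ₗ[MvPolynomial (Fin n) K]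
      ((t' : Branch (B.restrict (· ≠ i₀))) → (t : Branch (Blocks.single (B.S i₀) (B.nonempty i₀))) →
        MvPolynomial (Fin n) K ⧸
          (Ideal.span {(X t.1.2.2 : MvPolynomial (Fin n) K), X t.1.2.1} ⊔
            Ideal.span {(X t'.1.2.2 : MvPolynomial (Fin n) K), X t'.1.2.1})) :=
  ((rangeExtConnectingEquiv (devissage_shortExact_twoBlocks (K := K) B i₀ ha₀)
      (ModuleCat.of (MvPolynomial (Fin n) K) ↥(blockIdeal K (B.S i₀) ⊓ otherIdeal (K := K) B i₀)) 1).symm.trans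
    ((Submodule.Quotient.equiv _ _ _ (map_range_extPrecomp_eq_degree (K := K) B i₀ ha₀ 1)).trans
      ((quotRangeCongr (fun b a => hbMatrix (K := K) (B.S i₀) a₀ a b) (stepTwoOne (K := K) B i₀ ha₀ h2)).trans
        (flattenEquiv _ _).symm))).trans
    ((quotRelYPiEquiv _ _ (fun t' : Branch (B.restrict (· ≠ i₀)) =>
        MvPolynomial (Fin n) K ⧸ Ideal.span {(X t'.1.2.2 : MvPolynomial (Fin n) K), X t'.1.2.1})).trans
      (LinearEquiv.piCongrRight fun t' =>
        yQuotEquiv (K := K) B i₀ ha₀ (Ideal.span {(X t'.1.2.2 : MvPolynomial (Fin n) K), X t'.1.2.1})))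

/-! ### The quotient by `range ∂` and its structure -/

/-- The quotient piece, factor by factor: `ker(Φᵀ on ((R ⧸ J_{τ′})^S ⧸ Φ)-vectors) ≃ₗ[R] R ⧸ J_{τ′}` (file XL's core,
transported from `varIdeal (tupleVars τ′)` to `tupleIdeal τ′`). -/
noncomputable def kerFactorEquiv (τ : BranchTuple (B.restrict (· ≠ i₀))) :
    ↥(LinearMap.ker (scalarMatrix
        ((↥(B.S i₀) → QTuple (K := K) B i₀ τ) ⧸
          LinearMap.range (scalarMatrix (QTuple (K := K) B i₀ τ) (hbMatrix (K := K) (B.S i₀) a₀)))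
        (fun b a => hbMatrix (K := K) (B.S i₀) a₀ a b)))
      ≃ₗ[MvPolynomial (Fin n) K] QTuple (K := K) B i₀ τ :=
  let eq : QTuple (K := K) B i₀ τ ≃ₗ[MvPolynomial (Fin n) K]
      MvPolynomial (Fin n) K ⧸ varIdeal K (tupleVars (B.restrict (· ≠ i₀)) τ) :=
    Submodule.quotEquivOfEq _ _ (tupleIdeal_eq_varIdeal (K := K) (B.restrict (· ≠ i₀)) τ)
  ((kerScalarMatrixCongr (fun b a => hbMatrix (K := K) (B.S i₀) a₀ a b)
      (quotRangeCongr (hbMatrix (K := K) (B.S i₀) a₀) eq)).trans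
    (kerTransposeEquiv (K := K) (B.S i₀) (tupleVars (B.restrict (· ≠ i₀)) τ) ha₀
      (fun _ ha => notMem_tupleVars_restrict B i₀ τ ha)).symm).trans eq.symm

/-- `E₂I = Ext²(V, I_M) ≃ₗ[R] (Π_{τ′} R ⧸ J_{τ′})^S ⧸ range Φ` (file XXXVII's `stepTwoK` at degree `2`, `E₃ = 0`). -/
noncomputable def eKTwo :
    EK (K := K) B i₀ 2 ≃ₗ[MvPolynomial (Fin n) K]
      ((↥(B.S i₀) → (τ : BranchTuple (B.restrict (· ≠ i₀))) → QTuple (K := K) B i₀ τ) ⧸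
        LinearMap.range (scalarMatrix ((τ : BranchTuple (B.restrict (· ≠ i₀))) → QTuple (K := K) B i₀ τ)
          (hbMatrix (K := K) (B.S i₀) a₀))) :=
  stepTwoK (K := K) B i₀ ha₀ 2 (ext_three_otherIdeal_eq_zero (K := K) B i₀ h2) (eTwo (K := K) B i₀ h2)

/-- The kernel of `Φᵀ` on `E₂I`-valued vectors, factor by factor. -/
noncomputable def kerTwoEquiv :
    ↥(LinearMap.ker (scalarMatrix (EK (K := K) B i₀ 2) (fun b a => hbMatrix (K := K) (B.S i₀) a₀ a b)))
      ≃ₗ[MvPolynomial (Fin n) K] ((τ : BranchTuple (B.restrict (· ≠ i₀))) → QTuple (K := K) B i₀ τ) :=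
  ((kerScalarMatrixCongr (fun b a => hbMatrix (K := K) (B.S i₀) a₀ a b) (eKTwo (K := K) B i₀ ha₀ h2)).trans
    (kerScalarMatrixQuotPiEquiv (QTuple (K := K) B i₀) (hbMatrix (K := K) (B.S i₀) a₀)
      (fun b a => hbMatrix (K := K) (B.S i₀) a₀ a b))).trans
    (LinearEquiv.piCongrRight fun τ => kerFactorEquiv (K := K) B i₀ ha₀ τ)

/-- **THE QUOTIENT PIECE: `Ext²_R(I_M, I_M) ⧸ range ∂ ≃ₗ[R] Π_{τ′ ∈ BranchTuple M′} R ⧸ J_{τ′}`** — the pairwise crossing of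
the two other blocks. -/
noncomputable def midQuotEquiv :
    (Ext.{u} (ModuleCat.of (MvPolynomial (Fin n) K) ↥(blockIdeal K (B.S i₀) ⊓ otherIdeal (K := K) B i₀))
        (ModuleCat.of (MvPolynomial (Fin n) K) ↥(blockIdeal K (B.S i₀) ⊓ otherIdeal (K := K) B i₀)) 2 ⧸
      midSub (K := K) B i₀ ha₀) ≃ₗ[MvPolynomial (Fin n) K]
      ((τ : BranchTuple (B.restrict (· ≠ i₀))) → QTuple (K := K) B i₀ τ) :=
  -- `Ext² ⧸ range ∂ ≃ ker Φ^*₂ ≃ ker (Φᵀ on E₂I-vectors)`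
  ((quotRangeExtConnectingEquiv (devissage_shortExact_twoBlocks (K := K) B i₀ ha₀)
      (ModuleCat.of (MvPolynomial (Fin n) K) ↥(blockIdeal K (B.S i₀) ⊓ otherIdeal (K := K) B i₀)) 1).trans
    (kerEquivOfSquare _ _
      (extPiEquiv ↥(otherIdeal (K := K) B i₀) ↥(B.S i₀)
        (ModuleCat.of (MvPolynomial (Fin n) K) ↥(blockIdeal K (B.S i₀) ⊓ otherIdeal (K := K) B i₀)) 2)
      (extPiEquiv ↥(otherIdeal (K := K) B i₀) ↥((B.S i₀).erase a₀)
        (ModuleCat.of (MvPolynomial (Fin n) K) ↥(blockIdeal K (B.S i₀) ⊓ otherIdeal (K := K) B i₀)) 2)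
      (extPiEquiv_extPrecomp (K := K) B i₀ ha₀ 2))).trans
    -- `E₂I ≃ (S → Π_τ Q_τ) ⧸ Φ`, kernels factor by factor
    (kerTwoEquiv (K := K) B i₀ ha₀ h2)

/-- **The quotient piece, intrinsically: `Ext²_R(I_M, I_M) ⧸ range ∂ ≃ₗ[R] Ext²_R(I_{M′}, I_{M′})`** (`= Hom_R(I_S, I_S) ⊗ Ext²(V, V)`,
`Hom_R(I_S, I_S) = R`; composed with file XXXVII's `extEquivOfCardEq` for the two other blocks). -/
noncomputable def midQuotEquivExt :
    (Ext.{u} (ModuleCat.of (MvPolynomial (Fin n) K) ↥(blockIdeal K (B.S i₀) ⊓ otherIdeal (K := K) B i₀))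
        (ModuleCat.of (MvPolynomial (Fin n) K) ↥(blockIdeal K (B.S i₀) ⊓ otherIdeal (K := K) B i₀)) 2 ⧸
      midSub (K := K) B i₀ ha₀) ≃ₗ[MvPolynomial (Fin n) K] EPrimeK (K := K) B i₀ 2 :=
  (midQuotEquiv (K := K) B i₀ ha₀ h2).trans (eTwo (K := K) B i₀ h2).symm

/-! ### On `arrIdeal K B` and with `Fintype.card ι = 3` -/

/-- `Ext²_R(I_M, I_M)` on `arrIdeal K B` is `Ext²` on `I_S ∩ V` (file XXVII's `arrIdeal_eq_blockIdeal_inf_restrict`). -/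
noncomputable def extTwoArrEquiv :
    Ext.{u} (ModuleCat.of (MvPolynomial (Fin n) K) ↥(arrIdeal K B)) (ModuleCat.of (MvPolynomial (Fin n) K) ↥(arrIdeal K B)) 2
      ≃ₗ[MvPolynomial (Fin n) K]
        Ext.{u} (ModuleCat.of (MvPolynomial (Fin n) K) ↥(blockIdeal K (B.S i₀) ⊓ otherIdeal (K := K) B i₀))
          (ModuleCat.of (MvPolynomial (Fin n) K) ↥(blockIdeal K (B.S i₀) ⊓ otherIdeal (K := K) B i₀)) 2 :=
  extCongrOfEq (arrIdeal_eq_blockIdeal_inf_restrict (K := K) B i₀) 2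

/-- The sub-module of `Ext²_R(I_M, I_M)` on `arrIdeal K B`. -/
noncomputable def midSubArr : Submodule (MvPolynomial (Fin n) K)
    (Ext.{u} (ModuleCat.of (MvPolynomial (Fin n) K) ↥(arrIdeal K B))
      (ModuleCat.of (MvPolynomial (Fin n) K) ↥(arrIdeal K B)) 2) :=
  (midSub (K := K) B i₀ ha₀).comap (extTwoArrEquiv (K := K) B i₀ : _ →ₗ[MvPolynomial (Fin n) K] _)

/-- **§6.B(c) at a triple point, sub-piece, on `I_M = arrIdeal K B`.** -/
noncomputable def midSubEquivArr :
    ↥(midSubArr (K := K) B i₀ ha₀) ≃ₗ[MvPolynomial (Fin n) K]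
      ((t' : Branch (B.restrict (· ≠ i₀))) → (t : Branch (Blocks.single (B.S i₀) (B.nonempty i₀))) →
        MvPolynomial (Fin n) K ⧸
          (Ideal.span {(X t.1.2.2 : MvPolynomial (Fin n) K), X t.1.2.1} ⊔
            Ideal.span {(X t'.1.2.2 : MvPolynomial (Fin n) K), X t'.1.2.1})) :=
  (((extTwoArrEquiv (K := K) B i₀).submoduleMap (midSubArr (K := K) B i₀ ha₀)).trans
    (LinearEquiv.ofEq _ _ (Submodule.map_comap_eq_of_surjective (extTwoArrEquiv (K := K) B i₀).surjective _))).trans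
    (midSubEquiv (K := K) B i₀ ha₀ h2)

/-- **§6.B(c) at a triple point, quotient piece, on `I_M = arrIdeal K B`.** -/
noncomputable def midQuotEquivArr :
    (Ext.{u} (ModuleCat.of (MvPolynomial (Fin n) K) ↥(arrIdeal K B))
        (ModuleCat.of (MvPolynomial (Fin n) K) ↥(arrIdeal K B)) 2 ⧸ midSubArr (K := K) B i₀ ha₀)
      ≃ₗ[MvPolynomial (Fin n) K] ((τ : BranchTuple (B.restrict (· ≠ i₀))) → QTuple (K := K) B i₀ τ) :=
  (Submodule.Quotient.equiv _ _ (extTwoArrEquiv (K := K) B i₀)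
      (Submodule.map_comap_eq_of_surjective (extTwoArrEquiv (K := K) B i₀).surjective _)).trans
    (midQuotEquiv (K := K) B i₀ ha₀ h2)

end ThreeBlocks

/-- With exactly three indices, the complement of one index has two elements. -/
theorem card_ne_eq_two_of_card_eq_three {ι : Type} [Fintype ι] [DecidableEq ι] (h : Fintype.card ι = 3) (i₀ : ι) :
    Fintype.card {j // j ≠ i₀} = 2 := by
  rw [Fintype.card_subtype, Finset.filter_ne', Finset.card_erase_of_mem (Finset.mem_univ _), Finset.card_univ, h]

/-- **EXT-NOTE §6.B(c) at a crossing of THREE blocks, `q = 2`** (any commutative `K`, any `n`): for a block structure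
with `Fintype.card ι = 3`, `Ext²_R(I_M, I_M)` is an extension of `Π_{τ′} R ⧸ J_{τ′}` (branch tuples of the two blocks
other than `i₀`) by `Π_{t′} Π_{t} R ⧸ ((x_{t.b}, x_{t.a}) + (x_{t′.b}, x_{t′.a}))` (branches of block `i₀` against branches
of the other two) — the three pairwise plane terms at a triple point, and nothing else. -/
noncomputable def midQuotEquiv_ofCardEqThree {ι : Type} [Fintype ι] [DecidableEq ι] (B : Blocks ι n)
    (h3 : Fintype.card ι = 3) (i₀ : ι) {a₀ : Fin n} (ha₀ : a₀ ∈ B.S i₀) :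
    (Ext.{u} (ModuleCat.of (MvPolynomial (Fin n) K) ↥(arrIdeal K B))
        (ModuleCat.of (MvPolynomial (Fin n) K) ↥(arrIdeal K B)) 2 ⧸ midSubArr (K := K) B i₀ ha₀)
      ≃ₗ[MvPolynomial (Fin n) K]
        ((τ : BranchTuple (B.restrict (· ≠ i₀))) → MvPolynomial (Fin n) K ⧸ tupleIdeal K (B.restrict (· ≠ i₀)) τ) :=
  midQuotEquivArr (K := K) B i₀ ha₀ (card_ne_eq_two_of_card_eq_three h3 i₀)

/-- The sub-piece with `Fintype.card ι = 3`. -/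
noncomputable def midSubEquiv_ofCardEqThree {ι : Type} [Fintype ι] [DecidableEq ι] (B : Blocks ι n)
    (h3 : Fintype.card ι = 3) (i₀ : ι) {a₀ : Fin n} (ha₀ : a₀ ∈ B.S i₀) :
    ↥(midSubArr (K := K) B i₀ ha₀) ≃ₗ[MvPolynomial (Fin n) K]
      ((t' : Branch (B.restrict (· ≠ i₀))) → (t : Branch (Blocks.single (B.S i₀) (B.nonempty i₀))) →
        MvPolynomial (Fin n) K ⧸
          (Ideal.span {(X t.1.2.2 : MvPolynomial (Fin n) K), X t.1.2.1} ⊔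
            Ideal.span {(X t'.1.2.2 : MvPolynomial (Fin n) K), X t'.1.2.1})) :=
  midSubEquivArr (K := K) B i₀ ha₀ (card_ne_eq_two_of_card_eq_three h3 i₀)

end Summit.Ventures.HSemireg.ObstructionLocus.BlockModel
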